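import Literature.IUT.HodgeTheaters.Cor53iFcircHdescOfAutDescendsModInner
import Literature.IUT.HodgeTheaters.GlobalFrobenioidsPushCarrierGaloisRich
import HarnessLib

/-!
# [IUTchI] Cor 5.3 (i) «respectively ⊚»: the descent binder `hdesc⊚` at the push carrier of ANY open homomorphism
# `ι : Π → G` — in particular an open EMBEDDING `π₁(†𝒟^⊚) ↪ π₁(†𝒟^⊛)` — REDUCED to «every topological automorphism of `Π`
# extends along `ι` up to an inner automorphism of `G`»

S. Mochizuki, *Inter-universal Teichmüller theory I*, kurims manuscript (May 2020), §5 Cor 5.3 (i) p. 144 l. 2–11, proof l. 24–28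
(cf. the (iv) argument p. 144 l. 37–40: «automorphisms of `𝒟_v` … necessarily arise from automorphisms of the scheme», the printed
analogue of «automorphisms extend along `ι`»); Example 5.1 (i) p. 123 l. 33–38 («a profinite group corresponding to `C_{F_mod}` … which contains `π₁(†𝒟^⊚)` as an open
subgroup … so we obtain a natural morphism `†𝒟^⊚ → †𝒟^⊛`», i.e. the push-forward along an open INJECTION of fundamental groups),
(iii) pp. 125–126 ([IUTchI] Cor 5.3 (i) p.144) [claim: Mochizuki2012, status: disputed] (D-0012 claim key; nothing of the series is
asserted; no side taken on [IUTchIII] Cor. 3.12).  [FrdII] Ex 1.3 (ii) p. 11 (push-forward `φ_*` / pull-back on `𝓑^temp(Π)⁰`, the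
tree's `CosetCat.push` / `CosetCat.pull`) [cite: MochizukiFrdII2008, Ex 1.3 (ii) p.11]; [SemiAnbd] Prop 3.2 p. 35 (equivalences of
connected temperoids are restrictions along topological isomorphisms; inner automorphisms act trivially up to isomorphism)
[cite: MochizukiSemiAnbd2006, Prop 3.2 p.35].

PROOF-ONLY (cell abc-iut, seat abc-iut-L5-t4 gen 10, row «HDESC@OPEN-EMBEDDING mod NU» FILE 1 = (E1) of abc-iut-L5-lead RULINGS #204;
0 def · 0 instance · 0 notation · no Prop fact).  abc-iut-L5-t1's ★ `Cor53iFcircHdescOfAutDescendsModInner` reduces the displayed law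
`hdesc⊚` of abc-iut-w4-d109's ★ `Cor53iLiftsAllAtFcirc` to

  `AutCompatible ι` :≡ `∀ φ : Π ≃ₜ* Π, ∃ (φ₀ : G ≃ₜ* G) (g : G), ∀ x, ι (φ x) = g * φ₀ (ι x) * g⁻¹`

(spelled out in the binders, no definition; = abc-iut-L5-lead's «AutExtendsAlong ι» of RULINGS #204; byte-identical to t1's
`AutDescendsModInner ρ`) — but only for a continuous open SURJECTION `ρ`: its square `push ρ ∘ pull φ⁻¹ ≅ pull φ₀⁻¹ ∘ push ρ` goes
through the adjunction `push ρ ⊣ pull ρ`, and `CosetCat.pull ρ` is typed for surjections only.  Print's `†𝒟^⊚ → †𝒟^⊛` is the push-forward along an open INJECTION.  THIS FILE removes the surjectivity: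
* §1 `CosetCat.nonempty_pull_symm_push_iso_push_pull_symm_of_comp` — for ANY open homomorphism `ι : Π → G` and topological automorphisms
  `ψ` of `Π`, `β` of `G` with `ι ∘ ψ = β ∘ ι`: `pull ψ⁻¹ ⋙ push ι ≅ push ι ⋙ pull β⁻¹` DIRECTLY (both send `Π/U` to `G/ι(ψU) = G/β(ιU)`;
  components `1 ↦ 1`); `…_of_conj` — with `ι (ψ x) = g · φ₀ (ι x) · g⁻¹`: `pull ψ⁻¹ ⋙ push ι ≅ push ι ⋙ pull φ₀⁻¹` (`β := Inn(g) ∘ φ₀`, then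
  abc-iut-L5-t2's ★ `CosetCat.nonempty_iso_pull_of_forall_conj`); `CosetCat.exists_push_descends_of_autCompatible` — every
  self-equivalence of `CosetCat Π` (`Π` Galois-countable tempered) descends along `push ι`, given `AutCompatible ι`
  (★ `CosetCat.exists_continuousMulEquiv_nonempty_iso_pull`: `Θ ≅ pull ψ⁻¹`);
* §2 **`GlobalFrobenioid.hdesc_of_autCompatible`** — t1's ★ `hdesc_of_autDescendsModInner` with the hypothesis `Surjective ρ` DROPPED
  (t1's ★ `CatIsomorphism.descends_of_equivalences` BY NAME), and **`GlobalFrobenioid.hdesc_pushCarrier_of_autCompatible`** — `hdesc⊚`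
  VERBATIM at the LITERAL push carrier `baseToCoset H ⋙ CosetCat.push ι ⋙ cosetToBase G_F` of ★ `GlobalFrobenioidsPushCarrierGaloisRich` §4;
* §3 KNIT **`Cor53.fcirc_descendBijective_of_pushCarrier_of_autCompatible_of_neukirchUchida (hNU) (hZ) (hAE) (𝓕)`** — [IUTchI]
  Cor 5.3 (i) «resp. `⊚`» AS PRINTED («bijective») at EVERY push carrier of a continuous open `ι : H → G_F` (`H` profinite,
  Galois-countable), for EVERY record: ⟸ LAW {`AutCompatible ι`} · FACT {`NeukirchUchida F`} · {`hZ : IsSlimGroup H`}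
  (abc-iut-L5-t11's ★ `Cor53.fcirc_descendBijective_of_galoisRich_of_lifts`, `hS` := ★ `exists_galoisRich_of_pushCarrier`,
  `hlift⊚` := abc-iut-w4-d109's ★ `liftsAll_fcircBase_arith_of_desc_of_neukirchUchida` fed by §2).
FILE 2 (`Cor53iFcircBijectiveAtOpenEmbedding`) discharges `AutCompatible ι` for open EMBEDDINGS into `G_F` from `NeukirchUchida F` + the EXTRA
side hypothesis «`F/ℚ` normal» (NOT a clause of [IUTchI] Def 3.1, whose (b) assumes `F/F_mod` Galois).  NON-VACUITY of the law: at `ι := id`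
it holds trivially (t1's ★ `CosetCat.autDescendsModInner_id`).

HONEST LABEL: «`hdesc⊚` REDUCED to `AutCompatible ι`»; a reduction re-labels a displayed binder, it discharges nothing in print's sense
(print's surjectivity is functorial reconstruction, not descent to `†𝒟^⊛`); OUR carriers; typed ≠ inhabited ≠ proved; nothing here
asserts abc proved or refuted.
-/

noncomputable section

namespace Literature.AnabelianGeometry.SemiGraphs

open CategoryTheory Function

namespace CosetCat

universe u

variable {P : Type u} [Group P] [TopologicalSpace P]
  {G : Type u} [Group G] [TopologicalSpace G]

/-! ### §1. The square `pull ψ⁻¹ ⋙ push ι ≅ push ι ⋙ pull φ₀⁻¹` for ANY open homomorphism `ι` -/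

/-- **`push ι ∘ pull ψ⁻¹ ≅ pull β⁻¹ ∘ push ι` whenever `ι ∘ ψ = β ∘ ι`** ([FrdII] Ex 1.3 (ii): `φ_*`, pull-back), for ANY open
homomorphism `ι : Π → G` (no surjectivity, no injectivity) and topological automorphisms `ψ` of `Π`, `β` of `G`: both composites send
`Π/U` to the SAME object `G/ι(ψU) = G/β(ιU)` and a `Π`-map with point `h·U'` to the `G`-map with point `ι(ψ h) = β(ι h)`; the
isomorphism has components `1·ι(ψU) ↦ 1·β(ιU)`. [cite: MochizukiFrdII2008, Ex 1.3 (ii) p.11] -/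
theorem nonempty_pull_symm_push_iso_push_pull_symm_of_comp (ι : P →* G) (ho : IsOpenMap ι)
    (ψ : P ≃ₜ* P) (hcψ : Continuous ψ.symm.toMonoidHom) (hsψ : Function.Surjective ψ.symm.toMonoidHom)
    (β : G ≃ₜ* G) (hcβ : Continuous β.symm.toMonoidHom) (hsβ : Function.Surjective β.symm.toMonoidHom)
    (h : ∀ x, ι (ψ x) = β (ι x)) :
    Nonempty (pull ψ.symm.toMonoidHom hcψ hsψ ⋙ push ι ho ≅ push ι ho ⋙ pull β.symm.toMonoidHom hcβ hsβ) := by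
  have h' : ∀ x, ι (ψ.symm x) = β.symm (ι x) := fun x => by
    apply β.injective
    rw [← h, ContinuousMulEquiv.apply_symm_apply, ContinuousMulEquiv.apply_symm_apply]
  -- the objects agree: `y ∈ ι(ψ U) ↔ β⁻¹ y ∈ ι(U)`
  have hmem : ∀ (X : CosetCat P) (y : G),
      y ∈ ((push ι ho).obj ((pull ψ.symm.toMonoidHom hcψ hsψ).obj X)).sg ↔
        y ∈ ((pull β.symm.toMonoidHom hcβ hsβ).obj ((push ι ho).obj X)).sg := by
    intro X y
    change y ∈ mapOpen ι ho (X.sg.comap ψ.symm.toMonoidHom hcψ) ↔ β.symm.toMonoidHom y ∈ mapOpen ι ho X.sg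
    rw [mem_mapOpen, mem_mapOpen]
    constructor
    · rintro ⟨π, hπ, rfl⟩
      exact ⟨ψ.symm π, hπ, h' π⟩
    · rintro ⟨u, hu, hu'⟩
      refine ⟨ψ u, ?_, ?_⟩
      · change ψ.symm (ψ u) ∈ X.sg
        rwa [ContinuousMulEquiv.symm_apply_apply]
      · rw [h u, ← ContinuousMulEquiv.eq_symm_apply]
        exact hu'
  -- the components `1 ↦ 1` both ways
  have hfix : ∀ X : CosetCat P, ∀ u ∈ ((push ι ho).obj ((pull ψ.symm.toMonoidHom hcψ hsψ).obj X)).sg,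
      u • ((1 : G) : ((pull β.symm.toMonoidHom hcβ hsβ).obj ((push ι ho).obj X)).carrier) =
        ((1 : G) : ((pull β.symm.toMonoidHom hcβ hsβ).obj ((push ι ho).obj X)).carrier) :=
    fun X u hu => (smul_one_eq_one_iff _ u).mpr ((hmem X u).mp hu)
  have hfix' : ∀ X : CosetCat P, ∀ u ∈ ((pull β.symm.toMonoidHom hcβ hsβ).obj ((push ι ho).obj X)).sg,
      u • ((1 : G) : ((push ι ho).obj ((pull ψ.symm.toMonoidHom hcψ hsψ).obj X)).carrier) =
        ((1 : G) : ((push ι ho).obj ((pull ψ.symm.toMonoidHom hcψ hsψ).obj X)).carrier) :=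
    fun X u hu => (smul_one_eq_one_iff _ u).mpr ((hmem X u).mpr hu)
  -- naturality: for `f` with point `a·U'` both composites send `1` to the coset of `ι (ψ a) = β (ι a)`
  have hnat : ∀ {X Y : CosetCat P} (f : X ⟶ Y),
      (push ι ho).map ((pull ψ.symm.toMonoidHom hcψ hsψ).map f) ≫ homMk _ (hfix Y) =
        homMk _ (hfix X) ≫ (pull β.symm.toMonoidHom hcβ hsβ).map ((push ι ho).map f) := by
    intro X Y f
    obtain ⟨a, ha⟩ := Quotient.exists_rep (pt f)
    have ha' : pt f = ((a : P) : Y.carrier) := ha.symm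
    have hψa : ψ.symm.toMonoidHom (ψ a) = a := ψ.symm_apply_apply a
    have hβa : β.symm.toMonoidHom (β (ι a)) = ι a := β.symm_apply_apply (ι a)
    have hpush : pt ((push ι ho).map f) = ((ι a : G) : ((push ι ho).obj Y).carrier) := by
      rw [pt_push_map, ha', pushQuot_coe]
    refine hom_ext ?_
    rw [pt_comp, pt_push_map, pt_pull_map_coe ψ.symm.toMonoidHom _ _ f ha' hψa, pushQuot_coe,
      homMk_toFun_coe, MulAction.Quotient.smul_coe, smul_eq_mul, mul_one, pt_comp, pt_homMk,
      toFun_coe, one_smul, pt_pull_map_coe β.symm.toMonoidHom _ _ ((push ι ho).map f) hpush hβa, h a]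
  have hhi : ∀ X : CosetCat P, homMk _ (hfix X) ≫ homMk _ (hfix' X) =
      𝟙 ((push ι ho).obj ((pull ψ.symm.toMonoidHom hcψ hsψ).obj X)) := fun X =>
    hom_ext (by rw [pt_comp, pt_homMk, homMk_toFun_coe, one_smul, pt_id])
  have hih : ∀ X : CosetCat P, homMk _ (hfix' X) ≫ homMk _ (hfix X) =
      𝟙 ((pull β.symm.toMonoidHom hcβ hsβ).obj ((push ι ho).obj X)) := fun X =>
    hom_ext (by rw [pt_comp, pt_homMk, homMk_toFun_coe, one_smul, pt_id])
  exact ⟨NatIso.ofComponents (fun X =>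
    { hom := homMk _ (hfix X)
      inv := homMk _ (hfix' X)
      hom_inv_id := hhi X
      inv_hom_id := hih X })
    (fun f => hnat f)⟩

/-- **`push ι ∘ pull ψ⁻¹ ≅ pull φ₀⁻¹ ∘ push ι` whenever `ι (ψ x) = g · φ₀ (ι x) · g⁻¹`** — the square of abc-iut-L5-t1's ★
`nonempty_pull_symm_push_iso_push_pull_symm` WITHOUT the surjectivity of `ι`: the preceding square with `β := Inn(g) ∘ φ₀`, then
`pull β⁻¹ ≅ pull φ₀⁻¹` because `β⁻¹` and `φ₀⁻¹` differ by conjugation by `g` ([SemiAnbd] Prop 3.2: inner automorphisms act trivially up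
to isomorphism; abc-iut-L5-t2's ★ `nonempty_iso_pull_of_forall_conj`). [cite: MochizukiSemiAnbd2006, Prop 3.2 p.35] -/
theorem nonempty_pull_symm_push_iso_push_pull_symm_of_conj [IsTopologicalGroup G] (ι : P →* G) (ho : IsOpenMap ι)
    (ψ : P ≃ₜ* P) (hcψ : Continuous ψ.symm.toMonoidHom) (hsψ : Function.Surjective ψ.symm.toMonoidHom)
    (φ₀ : G ≃ₜ* G) (hcφ : Continuous φ₀.symm.toMonoidHom) (hsφ : Function.Surjective φ₀.symm.toMonoidHom)
    (g : G) (hg : ∀ x, ι (ψ x) = g * φ₀ (ι x) * g⁻¹) :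
    Nonempty (pull ψ.symm.toMonoidHom hcψ hsψ ⋙ push ι ho ≅ push ι ho ⋙ pull φ₀.symm.toMonoidHom hcφ hsφ) := by
  -- `β := Inn(g) ∘ φ₀`
  let c : G ≃ₜ* G := ContinuousMulEquiv.mk (MulAut.conj g)
    ((continuous_const.mul continuous_id).mul continuous_const) ((continuous_const.mul continuous_id).mul continuous_const)
  let β : G ≃ₜ* G := φ₀.trans c
  have hβ : ∀ y, β y = g * φ₀ y * g⁻¹ := fun y => rfl
  have hβs : ∀ y, β.symm y = φ₀.symm (g⁻¹ * y * g) := fun y => by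
    apply β.injective
    rw [ContinuousMulEquiv.apply_symm_apply, hβ, ContinuousMulEquiv.apply_symm_apply]
    group
  obtain ⟨sq⟩ := nonempty_pull_symm_push_iso_push_pull_symm_of_comp ι ho ψ hcψ hsψ β β.symm.continuous
    β.symm.surjective (fun x => by rw [hβ, hg])
  -- `pull β⁻¹ ≅ pull φ₀⁻¹`
  obtain ⟨j⟩ := nonempty_iso_pull_of_forall_conj φ₀.symm.toMonoidHom β.symm.toMonoidHom hcφ hsφ
    β.symm.continuous β.symm.surjective g (fun π => by
      change β.symm (g * π * g⁻¹) = φ₀.symm π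
      rw [hβs]
      congr 1
      group)
  exact ⟨sq ≪≫ Functor.isoWhiskerLeft (push ι ho) j⟩

/-- **Every self-equivalence of `CosetCat Π` descends along `push ι`, given `AutCompatible ι`** — for ANY open homomorphism
`ι : Π → G` (`Π` Galois-countable tempered; e.g. an open embedding `π₁(†𝒟^⊚) ↪ π₁(†𝒟^⊛)`): `Θ ≅ pull ψ⁻¹` by [SemiAnbd] Prop 3.2
(abc-iut-L5-t2's ★ `exists_continuousMulEquiv_nonempty_iso_pull`), `ψ` extends to `φ₀` modulo `Inn(g)`, and the preceding square gives
`Θ ⋙ push ι ≅ push ι ⋙ pull φ₀⁻¹`.  (abc-iut-L5-t1's ★ `exists_push_descends_of_autDescendsModInner` = the case `ι` surjective.)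
([IUTchI] Cor 5.3 (i) p.144) [cite: MochizukiSemiAnbd2006, Prop 3.2 p.35] [claim: Mochizuki2012, status: disputed] -/
theorem exists_push_descends_of_autCompatible [IsTopologicalGroup P] [SecondCountableTopology P] [IsTopologicalGroup G]
    (hP : IsTempered P) (ι : P →* G) (ho : IsOpenMap ι)
    (hAE : ∀ φ : P ≃ₜ* P, ∃ (φ₀ : G ≃ₜ* G) (g : G), ∀ x, ι (φ x) = g * φ₀ (ι x) * g⁻¹)
    (Θ : CosetCat P ≌ CosetCat P) :
    ∃ Θ₀ : CosetCat G ≌ CosetCat G, Nonempty (Θ.functor ⋙ push ι ho ≅ push ι ho ⋙ Θ₀.functor) := by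
  obtain ⟨ψ, hcψ, hsψ, ⟨iΘ⟩⟩ := exists_continuousMulEquiv_nonempty_iso_pull hP hP Θ
  obtain ⟨φ₀, g, hg⟩ := hAE ψ
  obtain ⟨sq⟩ := nonempty_pull_symm_push_iso_push_pull_symm_of_conj ι ho ψ hcψ hsψ φ₀ φ₀.symm.continuous
    φ₀.symm.surjective g hg
  haveI := pull_isEquivalence_of_continuousMulEquiv φ₀.symm
  exact ⟨(pull φ₀.symm.toMonoidHom φ₀.symm.continuous φ₀.symm.surjective).asEquivalence,
    ⟨Functor.isoWhiskerRight iΘ (push ι ho) ≪≫ sq⟩⟩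

end CosetCat

end Literature.AnabelianGeometry.SemiGraphs

namespace Literature.IUT.HodgeTheaters

open CategoryTheory Function Literature.AlgebraicGeometry.Frobenioids Literature.AnabelianGeometry.SemiGraphs
open Literature.AlgebraicGeometry.Frobenioids.QuasiTemperoid Literature.NumberTheory.GaloisRepresentations

/-! ### §2. `hdesc⊚` at the push carrier of any open homomorphism, reduced to `AutCompatible ι` -/

namespace GlobalFrobenioid

universe u

variable {Gq : ProfiniteGrp.{u}} {Δ : GlobalDivisorData Gq} {Dcirc : Type (u + 1)} [Category.{u} Dcirc]
  {toBase0 : Dcirc ⥤ BaseCat Gq} (𝓕 : GlobalFrobenioid Δ Dcirc toBase0)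
  {P : Type u} [Group P] [TopologicalSpace P] [IsTopologicalGroup P] [SecondCountableTopology P]
  {G : Type u} [Group G] [TopologicalSpace G] [IsTopologicalGroup G]

/-- **`hdesc⊚` REDUCED to `AutCompatible ι` at the instance `†𝒟^⊚ → †𝒟^⊛ := push ι`, `ι` ANY open homomorphism** (abc-iut-L5-t1's ★
`hdesc_of_autDescendsModInner` with the hypothesis `Surjective ρ` dropped — so it now covers print's open INJECTION
`π₁(†𝒟^⊚) ↪ π₁(†𝒟^⊛)` of [IUTchI] Ex 5.1 (i)): for every `⊚`-record `𝓕` whose structure functor `toBase0` is, up to equivalences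
`e : †𝒟^⊚ ≌ CosetCat Π`, `i : †𝒟^⊛ ≌ CosetCat G`, the push-forward along `ι` (`toBase0 ⋙ i ≅ e ⋙ push ι`), the binder `hdesc⊚` of
abc-iut-w4-d109's ★ `GlobalFrobenioid.liftsAll_fcircBase_arith_of_desc_of_neukirchUchida` HOLDS VERBATIM ⟸ `AutCompatible ι` (§1,
transported twice by t1's ★ `CatIsomorphism.descends_of_equivalences`).  A reduction re-labels the displayed binder; it discharges
nothing in print's sense. ([IUTchI] Cor 5.3 (i) p.144) [cite: MochizukiSemiAnbd2006, Prop 3.2 p.35] [claim: Mochizuki2012, status: disputed] -/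
theorem hdesc_of_autCompatible (hP : IsTempered P) (ι : P →* G) (ho : IsOpenMap ι)
    (e : Dcirc ≌ CosetCat P) (i : BaseCat Gq ≌ CosetCat G) (hinst : toBase0 ⋙ i.functor ≅ e.functor ⋙ CosetCat.push ι ho)
    (hAE : ∀ φ : P ≃ₜ* P, ∃ (φ₀ : G ≃ₜ* G) (g : G), ∀ x, ι (φ x) = g * φ₀ (ι x) * g⁻¹) :
    ∀ Θ : Dcirc ≌ Dcirc, ∃ ΘB : 𝓕.Base ≌ 𝓕.Base, Nonempty (Θ.functor ⋙ 𝓕.baseMor ≅ 𝓕.baseMor ⋙ ΘB.functor) := by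
  have h0 : ∀ Θ : Dcirc ≌ Dcirc, ∃ Θ₀ : BaseCat Gq ≌ BaseCat Gq, Nonempty (Θ.functor ⋙ toBase0 ≅ toBase0 ⋙ Θ₀.functor) :=
    CatIsomorphism.descends_of_equivalences (CosetCat.push ι ho) toBase0 e i hinst
      (CosetCat.exists_push_descends_of_autCompatible hP ι ho hAE)
  exact CatIsomorphism.descends_of_equivalences toBase0 𝓕.baseMor 𝓕.α₁ 𝓕.identify 𝓕.compat.symm h0

end GlobalFrobenioid

/-- **`hdesc⊚` VERBATIM at the LITERAL push carrier `ℬ(H)⁰ → CosetCat H → CosetCat G_F → ℬ(G_F)⁰` of ★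
`GlobalFrobenioidsPushCarrierGaloisRich` §4** (`toBase0 := baseToCoset H ⋙ CosetCat.push ι ⋙ cosetToBase G_F`; `H` profinite and
Galois-countable, `ι : H → G_F` continuous open — e.g. an open embedding), for EVERY divisor data `Δ` and EVERY record, ⟸ LAW
{`AutCompatible ι`} (`e := baseToCoset H`, `i := (cosetToBase G_F)⁻¹`, both equivalences).
([IUTchI] Ex 5.1 (iii) p.125) [cite: MochizukiFrdII2008, Ex 1.3 (ii) p.11] [claim: Mochizuki2012, status: disputed] -/
theorem GlobalFrobenioid.hdesc_pushCarrier_of_autCompatible (F : Type) [Field F] [NumberField F]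
    (H : ProfiniteGrp.{0}) [SecondCountableTopology H] (ι : H →* GalFbar F) (ho : IsOpenMap ι)
    (hAE : ∀ φ : H ≃ₜ* H, ∃ (φ₀ : GalFbar F ≃ₜ* GalFbar F) (g : GalFbar F), ∀ x, ι (φ x) = g * φ₀ (ι x) * g⁻¹)
    {Δ : GlobalDivisorData (absGalGrp F)}
    (𝓕 : GlobalFrobenioid Δ (BaseCat H) (baseToCoset H ⋙ CosetCat.push ι ho ⋙ cosetToBase (absGalGrp F))) :
    ∀ Θ : BaseCat H ≌ BaseCat H, ∃ ΘB : 𝓕.Base ≌ 𝓕.Base, Nonempty (Θ.functor ⋙ 𝓕.baseMor ≅ 𝓕.baseMor ⋙ ΘB.functor) := by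
  haveI := BCat.connectedToBTemp_isEquivalence H
  haveI := BCat.connectedToBTemp_isEquivalence (absGalGrp F)
  haveI := CosetCat.toConnected_isEquivalence (IsTempered.of_profinite (G := absGalGrp F))
  let j := (cosetToBase (absGalGrp F)).asEquivalence
  refine 𝓕.hdesc_of_autCompatible (IsTempered.of_profinite (G := H)) ι ho (baseToCoset H).asEquivalence j.symm ?_ hAE
  -- `(baseToCoset ⋙ push ι ⋙ cosetToBase) ⋙ cosetToBase⁻¹ ≅ baseToCoset ⋙ push ι`
  exact Functor.associator _ _ _ ≪≫ Functor.isoWhiskerLeft _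
    (Functor.associator _ _ _ ≪≫ Functor.isoWhiskerLeft _ j.unitIso.symm ≪≫ Functor.rightUnitor _)

/-! ### §3. KNIT — [IUTchI] Cor 5.3 (i) «resp. ⊚» AS PRINTED at EVERY push carrier, modulo LAW {`AutCompatible ι`} · FACT {NU} · {`hZ`} -/

/-- **[IUTchI] Cor 5.3 (i) «resp. `⊚`» AS PRINTED («bijective») at the push carrier of ANY continuous open `ι : H → G_F`** (`H`
profinite, Galois-countable; e.g. print's open embedding `π₁(†𝒟^⊚) ↪ π₁(†𝒟^⊛)`), for EVERY record `𝓕`: the §0 natural map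
`Aut(†ℱ^⊚) → Aut(†𝒟^⊚)` is BIJECTIVE ⟸ LAW {`AutCompatible ι`} · FACT {`NeukirchUchida F`} · {`hZ : IsSlimGroup H`} —
abc-iut-L5-t11's ★ `Cor53.fcirc_descendBijective_of_galoisRich_of_lifts` with `hS` := ★ `GlobalFrobenioid.exists_galoisRich_of_pushCarrier`
and `hlift⊚` := abc-iut-w4-d109's ★ `liftsAll_fcircBase_arith_of_desc_of_neukirchUchida`, whose `hdesc⊚` is §2.  (FILE 2 discharges the
law for open EMBEDDINGS from `NeukirchUchida F` + the extra side hypothesis «`F/ℚ` normal»; `hZ` there from the slimness of `G_F`.)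
([IUTchI] Cor 5.3 (i) p.144) [cite: NeukirchSchmidtWingberg2008, Thm (12.2.1)] [claim: Mochizuki2012, status: disputed] -/
theorem Cor53.fcirc_descendBijective_of_pushCarrier_of_autCompatible_of_neukirchUchida (F : Type) [Field F] [NumberField F]
    (hNU : NeukirchUchida F) (H : ProfiniteGrp.{0}) [SecondCountableTopology H] (ι : H →* GalFbar F) (hc : Continuous ι)
    (ho : IsOpenMap ι) (hZ : IsSlimGroup H)
    (hAE : ∀ φ : H ≃ₜ* H, ∃ (φ₀ : GalFbar F ≃ₜ* GalFbar F) (g : GalFbar F), ∀ x, ι (φ x) = g * φ₀ (ι x) * g⁻¹)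
    (𝓕 : GlobalFrobenioid (GlobalDivisorData.arith F) (BaseCat H)
      (baseToCoset H ⋙ CosetCat.push ι ho ⋙ cosetToBase (absGalGrp F))) :
    CatIsomorphism.DescendBijective 𝓕.fcircBase 𝓕.fcircBase
      (GlobalFrobenioid.hasUnder_and_underUnique_fcircBase_arith_baseCat 𝓕 𝓕 hZ hZ).1
      (GlobalFrobenioid.hasUnder_and_underUnique_fcircBase_arith_baseCat 𝓕 𝓕 hZ hZ).2 := by
  haveI := BCat.connectedToBTemp_essSurj H
  obtain ⟨c, -⟩ := Functor.EssSurj.mem_essImage (F := baseToCoset H) (CosetCat.top : CosetCat H)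
  exact Cor53.fcirc_descendBijective_of_galoisRich_of_lifts 𝓕 hZ
    (GlobalFrobenioid.exists_galoisRich_of_pushCarrier F H ι hc ho 𝓕 c)
    (𝓕.liftsAll_fcircBase_arith_of_desc_of_neukirchUchida
      (GlobalFrobenioid.hdesc_pushCarrier_of_autCompatible F H ι ho hAE 𝓕) hNU)

end Literature.IUT.HodgeTheaters
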